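import Literature.Probability.Percolation.BKWOrientationExpansion

/-!
# Stub `stub_realisability` of line `rainbow-monomials-in-excursion-kernels` — Part 5:
# the Baxter–Kelland–Wu orientation expansion with cut loops and forced strand orientations
# (crux `BoundaryDefectGaussianR`, stmt-CriticalPhenomena-14132)

The abstract algebraic core of the insertion dictionary **D2** of
`Literature.Probability.LatticeModels.CollarLegModel`, lattice-free. The tree's
`Literature.Probability.Percolation.BKW.prod_cycles_two_cos_eq_sum_invariant`
(`Literature/Probability/Percolation/BKWOrientationExpansion.lean`) expands the product of the
loop weights `2cos(∑_{c∈S} g c)` over the cycles `S` of a permutation `σ` of a finite type `C` of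
corners as the sum over the `σ`-invariant arrow configurations `s : C → Bool`. With leg
insertions the medial loops are CUT after the corners of a set `B : Finset C`: an arrow
configuration is then only required to be **consistent**, `s (σ c) = s c` for `c ∉ B`, so that

* on an **uncut cycle** `S` (`Disjoint S B`) it is constant, with a free bit;
* on the **strand** `T_b = {c | ∃ k < card C, σ^k c = b ∧ ∀ l < k, σ^l c ∉ B}` ending at the cut
  corner `b ∈ B` (the corners whose first visit to `B` along `σ` is `b`: the maximal `σ`-interval
  `…, σ⁻² b, σ⁻¹ b, b` avoiding `B` before `b`) it is constant, equal to its bit at `b`, which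
  is FORCED when the bits on `B` are prescribed (`s = o` on `B`).

Main result of this Part (pure finite algebra over `{C : Type*} [Fintype C] [DecidableEq C]`,
no new definition — strands and uncut cycles are written out as finsets):

* `bkwStrand_sum_consistent_forced` — **forced orientations**:
  `∑_{s consistent, s = o on B} ∏_c exp(i ε(s c) g c)
     = ∏_{S uncut cycle} 2cos(∑_{c∈S} g c) · ∏_{b∈B} exp(i ε(o b) ∑_{c∈T_b} g c)`
  (uncut loops are summed over their two orientations, each open strand carries the single
  phase of its forced orientation).

The proof follows the tree file: the corners are partitioned into uncut cycles and strands
(`bkwStrand_prod_split`), the admissible configurations are the injective lifts of the free bits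
on the uncut cycles (`bkwStrand_filter_eq_image`), and `∑_f ∏_S = ∏_S ∑_bit`. Part 6 sums over
`o` (free orientations of the strands, `bkwStrand_sum_consistent`).

Registered sub-goal carried here: `s12_bkwStrandExpansion` (the forced identity, `C : Type`).
-/

noncomputable section

namespace Summit.CriticalPhenomena.CardyFormulaZ2.Cruxes.BoundaryDefectGaussianR.RainbowMonomialsInExcursionKernels

open Finset Complex Equiv Literature.Probability.Percolation.BKW
open Literature.GroupTheory.CombinatorialGroupTheory

variable {C : Type*} [Fintype C] [DecidableEq C]


/-! ### Strands of a permutation cut at a set of corners -/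

omit [Fintype C] [DecidableEq C] in
/-- **A consistent arrow configuration is constant along a stretch of orbit avoiding the cuts**:
if `σ^l c ∉ B` for `l < k` then `s (σ^k c) = s c`. [cite: BaxterKellandWu1976, §3] -/
theorem bkwStrand_apply_pow_eq {σ : Perm C} {B : Finset C} {s : C → Bool}
    (hs : ∀ c, c ∉ B → s (σ c) = s c) (c : C) {k : ℕ} (hk : ∀ l < k, (σ ^ l) c ∉ B) :
    s ((σ ^ k) c) = s c := by
  induction k with
  | zero => simp
  | succ k ih =>
    rw [pow_succ', Perm.mul_apply, hs _ (hk k k.lt_succ_self)]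
    exact ih fun l hl => hk l (Nat.lt_succ_of_lt hl)

omit [Fintype C] [DecidableEq C] in
/-- **The cut corner ending the strand through `c` is unique**: the first corner of `B` weakly
after `c` along `σ`. [folklore] -/
theorem bkwStrand_end_unique {σ : Perm C} {B : Finset C} {c b b' : C} {k k' : ℕ}
    (hb : b ∈ B) (hb' : b' ∈ B) (hk : (σ ^ k) c = b) (hkl : ∀ l < k, (σ ^ l) c ∉ B)
    (hk' : (σ ^ k') c = b') (hkl' : ∀ l < k', (σ ^ l) c ∉ B) : b = b' := by
  rcases lt_trichotomy k k' with h | rfl | h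
  · rw [← hk] at hb
    exact absurd hb (hkl' k h)
  · rw [← hk, ← hk']
  · rw [← hk'] at hb'
    exact absurd hb' (hkl k' h)

/-- **Existence of the strand end**: if the forward orbit of `c` meets `B`, its first visit to `B`
happens before time `card C`. [folklore] -/
theorem bkwStrand_exists_end {σ : Perm C} {B : Finset C} {c : C} (h : ∃ k, (σ ^ k) c ∈ B) :
    ∃ b ∈ B, ∃ k < Fintype.card C, (σ ^ k) c = b ∧ ∀ l < k, (σ ^ l) c ∉ B := by
  classical
  refine ⟨(σ ^ Nat.find h) c, Nat.find_spec h, Nat.find h, ?_, rfl, fun l hl => Nat.find_min h hl⟩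
  by_cases hc : c ∈ σ.support
  · have hy : σ.SameCycle c ((σ ^ Nat.find h) c) := ⟨Nat.find h, by rw [zpow_natCast]⟩
    obtain ⟨i, hi, hiy⟩ := hy.exists_pow_eq_of_mem_support hc
    have hle : Nat.find h ≤ i := Nat.find_min' h (by rw [hiy]; exact Nat.find_spec h)
    exact hle.trans_lt (hi.trans_le (card_le_univ _))
  · rw [Perm.notMem_support] at hc
    have h0 : Nat.find h = 0 := by
      rw [Nat.find_eq_zero]
      have := Nat.find_spec h
      rw [Perm.pow_apply_eq_self_of_apply_eq_self hc] at this
      simpa using this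
    rw [h0]
    exact Fintype.card_pos_iff.2 ⟨c⟩

/-- The cycle of `c` meets the cuts iff the forward orbit of `c` visits `B`. [folklore] -/
theorem bkwStrand_not_disjoint_iff {σ : Perm C} {B : Finset C} {c : C} :
    ¬ Disjoint (PairingGenus.cls σ c) B ↔ ∃ k : ℕ, (σ ^ k) c ∈ B := by
  rw [not_disjoint_iff]
  constructor
  · rintro ⟨y, hy, hyB⟩
    obtain ⟨k, rfl⟩ := (PairingGenus.mem_cls.1 hy).exists_nat_pow_eq
    exact ⟨k, hyB⟩
  · rintro ⟨k, hk⟩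
    exact ⟨_, PairingGenus.mem_cls.2 ⟨k, by rw [zpow_natCast]⟩, hk⟩

/-- **A strand-end function**: `e c ∈ B` is the first corner of `B` weakly after `c` along `σ`,
for every `c` whose cycle is cut. [folklore] -/
theorem bkwStrand_exists_endFun (σ : Perm C) (B : Finset C) :
    ∃ e : C → C, ∀ c, ¬ Disjoint (PairingGenus.cls σ c) B →
      e c ∈ B ∧ ∃ k < Fintype.card C, (σ ^ k) c = e c ∧ ∀ l < k, (σ ^ l) c ∉ B := by
  have h : ∀ c : C, ∃ b : C, ¬ Disjoint (PairingGenus.cls σ c) B →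
      b ∈ B ∧ ∃ k < Fintype.card C, (σ ^ k) c = b ∧ ∀ l < k, (σ ^ l) c ∉ B := by
    intro c
    by_cases hD : Disjoint (PairingGenus.cls σ c) B
    · exact ⟨c, fun h => absurd hD h⟩
    · obtain ⟨b, hb, hk⟩ := bkwStrand_exists_end (bkwStrand_not_disjoint_iff.1 hD)
      exact ⟨b, fun _ => ⟨hb, hk⟩⟩
  choose e he using h
  exact ⟨e, he⟩

/-! ### The partition of the corners into uncut cycles and strands -/

/-- A member of a cycle generates it. [folklore] -/
theorem bkwStrand_cls_eq_of_mem {σ : Perm C} {S : Finset C} (hS : S ∈ cycles σ) {c : C}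
    (hc : c ∈ S) : PairingGenus.cls σ c = S := by
  rw [← filter_cls_eq hS, mem_filter] at hc
  exact hc.2

/-- The cycle of a corner whose cycle avoids the cuts is an uncut cycle. [folklore] -/
theorem bkwStrand_cls_mem_uncut {σ : Perm C} {B : Finset C} {c : C}
    (h : Disjoint (PairingGenus.cls σ c) B) :
    PairingGenus.cls σ c ∈ (cycles σ).filter (fun S => Disjoint S B) :=
  mem_filter.2 ⟨cls_mem_cycles σ c, h⟩

/-- The fibre of `cls σ` over an uncut cycle, inside the uncut corners, is that cycle. [folklore] -/
theorem bkwStrand_filter_uncut_eq {σ : Perm C} {B : Finset C} {S : Finset C}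
    (hS : S ∈ (cycles σ).filter (fun S => Disjoint S B)) :
    ((univ.filter fun c => Disjoint (PairingGenus.cls σ c) B).filter
        fun c => PairingGenus.cls σ c = S) = S := by
  rw [mem_filter] at hS
  ext c
  simp only [mem_filter, mem_univ, true_and]
  constructor
  · rintro ⟨-, rfl⟩
    exact PairingGenus.mem_cls_self σ c
  · intro hc
    have h := bkwStrand_cls_eq_of_mem hS.1 hc
    exact ⟨by rw [h]; exact hS.2, h⟩

/-- The fibre of a strand-end function over `b ∈ B`, inside the cut corners, is the strand
`T_b = {c | ∃ k < card C, σ^k c = b ∧ ∀ l < k, σ^l c ∉ B}`. [folklore] -/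
theorem bkwStrand_filter_cut_eq {σ : Perm C} {B : Finset C} {e : C → C}
    (he : ∀ c, ¬ Disjoint (PairingGenus.cls σ c) B →
      e c ∈ B ∧ ∃ k < Fintype.card C, (σ ^ k) c = e c ∧ ∀ l < k, (σ ^ l) c ∉ B)
    {b : C} (hb : b ∈ B) :
    ((univ.filter fun c => ¬ Disjoint (PairingGenus.cls σ c) B).filter fun c => e c = b) =
      univ.filter fun c => ∃ k < Fintype.card C, (σ ^ k) c = b ∧ ∀ l < k, (σ ^ l) c ∉ B := by
  ext c
  simp only [mem_filter, mem_univ, true_and]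
  constructor
  · rintro ⟨hc, rfl⟩
    exact (he c hc).2
  · rintro ⟨k, hk, hkb, hkl⟩
    have hc : ¬ Disjoint (PairingGenus.cls σ c) B := bkwStrand_not_disjoint_iff.2 ⟨k, hkb ▸ hb⟩
    obtain ⟨heB, k', -, hke, hkl'⟩ := he c hc
    exact ⟨hc, bkwStrand_end_unique heB hb hke hkl' hkb hkl⟩

/-- **The product over corners splits along uncut cycles and strands** (the corners are
partitioned into the uncut cycles and the strands `T_b`, `b ∈ B`). [folklore] -/
theorem bkwStrand_prod_split {σ : Perm C} {B : Finset C} {e : C → C}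
    (he : ∀ c, ¬ Disjoint (PairingGenus.cls σ c) B →
      e c ∈ B ∧ ∃ k < Fintype.card C, (σ ^ k) c = e c ∧ ∀ l < k, (σ ^ l) c ∉ B)
    (F : C → ℂ) :
    ∏ c, F c = (∏ S ∈ (cycles σ).filter (fun S => Disjoint S B), ∏ c ∈ S, F c) *
      ∏ b ∈ B, ∏ c ∈ univ.filter
        (fun c => ∃ k < Fintype.card C, (σ ^ k) c = b ∧ ∀ l < k, (σ ^ l) c ∉ B), F c := by
  rw [← prod_filter_mul_prod_filter_not univ (fun c => Disjoint (PairingGenus.cls σ c) B)]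
  congr 1
  · rw [← prod_fiberwise_of_maps_to (g := PairingGenus.cls σ)
      (t := (cycles σ).filter (fun S => Disjoint S B))
      (fun c hc => bkwStrand_cls_mem_uncut (mem_filter.1 hc).2)]
    exact prod_congr rfl fun S hS => by rw [bkwStrand_filter_uncut_eq hS]
  · rw [← prod_fiberwise_of_maps_to (g := e) (t := B) (fun c hc => (he c (mem_filter.1 hc).2).1)]
    exact prod_congr rfl fun b hb => by rw [bkwStrand_filter_cut_eq he hb]

/-! ### Lifting bits on uncut cycles and on `B` to consistent arrow configurations -/

section Lift

variable {σ : Perm C} {B : Finset C} {e : C → C} {o : C → Bool}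
  {L : (↥((cycles σ).filter (fun S => Disjoint S B)) → Bool) → C → Bool}

/-- On an uncut cycle `S` a lift takes the value `f S`. [folklore] -/
theorem bkwStrand_lift_apply_of_mem
    (hL₁ : ∀ f c (h : Disjoint (PairingGenus.cls σ c) B),
      L f c = f ⟨PairingGenus.cls σ c, bkwStrand_cls_mem_uncut h⟩)
    (f : ↥((cycles σ).filter (fun S => Disjoint S B)) → Bool)
    (S : ↥((cycles σ).filter (fun S => Disjoint S B))) {c : C} (hc : c ∈ S.1) : L f c = f S := by
  have hcS : PairingGenus.cls σ c = S.1 := bkwStrand_cls_eq_of_mem (mem_filter.1 S.2).1 hc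
  have hD : Disjoint (PairingGenus.cls σ c) B := by rw [hcS]; exact (mem_filter.1 S.2).2
  rw [hL₁ f c hD]
  congr 1
  exact Subtype.ext hcS

/-- On the strand `T_b` a lift takes the forced value `o b`. [folklore] -/
theorem bkwStrand_lift_apply_of_mem_strand
    (he : ∀ c, ¬ Disjoint (PairingGenus.cls σ c) B →
      e c ∈ B ∧ ∃ k < Fintype.card C, (σ ^ k) c = e c ∧ ∀ l < k, (σ ^ l) c ∉ B)
    (hL₂ : ∀ f c, ¬ Disjoint (PairingGenus.cls σ c) B → L f c = o (e c))
    (f : ↥((cycles σ).filter (fun S => Disjoint S B)) → Bool) {b c : C} (hb : b ∈ B)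
    (hc : c ∈ univ.filter
      (fun c => ∃ k < Fintype.card C, (σ ^ k) c = b ∧ ∀ l < k, (σ ^ l) c ∉ B)) :
    L f c = o b := by
  rw [← bkwStrand_filter_cut_eq he hb, mem_filter, mem_filter] at hc
  rw [hL₂ f c hc.1.2, hc.2]

/-- **Lifts are consistent and have the forced bits on `B`.** [cite: BaxterKellandWu1976, §3] -/
theorem bkwStrand_lift_mem
    (he : ∀ c, ¬ Disjoint (PairingGenus.cls σ c) B →
      e c ∈ B ∧ ∃ k < Fintype.card C, (σ ^ k) c = e c ∧ ∀ l < k, (σ ^ l) c ∉ B)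
    (hL₁ : ∀ f c (h : Disjoint (PairingGenus.cls σ c) B),
      L f c = f ⟨PairingGenus.cls σ c, bkwStrand_cls_mem_uncut h⟩)
    (hL₂ : ∀ f c, ¬ Disjoint (PairingGenus.cls σ c) B → L f c = o (e c))
    (f : ↥((cycles σ).filter (fun S => Disjoint S B)) → Bool) :
    (∀ c, c ∉ B → L f (σ c) = L f c) ∧ ∀ c ∈ B, L f c = o c := by
  constructor
  · intro c hcB
    by_cases hD : Disjoint (PairingGenus.cls σ c) B
    · have hσc : σ c ∈ PairingGenus.cls σ c := PairingGenus.mem_cls.2 ⟨1, by rw [zpow_one]⟩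
      rw [bkwStrand_lift_apply_of_mem hL₁ f ⟨_, bkwStrand_cls_mem_uncut hD⟩
          (PairingGenus.mem_cls_self σ c),
        bkwStrand_lift_apply_of_mem hL₁ f ⟨_, bkwStrand_cls_mem_uncut hD⟩ hσc]
    · obtain ⟨heB, k, hk, hke, hkl⟩ := he c hD
      obtain _ | k := k
      · have hcB' : c ∈ B := by
          rw [← hke] at heB
          simpa using heB
        exact absurd hcB' hcB
      · have hσc : σ c ∈ univ.filter (fun c' => ∃ k < Fintype.card C,
            (σ ^ k) c' = e c ∧ ∀ l < k, (σ ^ l) c' ∉ B) := by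
          refine mem_filter.2 ⟨mem_univ _, k, k.lt_succ_self.trans hk, ?_, fun l hl => ?_⟩
          · rw [← hke, pow_succ, Perm.mul_apply]
          · rw [← Perm.mul_apply, ← pow_succ]
            exact hkl (l + 1) (Nat.succ_lt_succ hl)
        have hcc : c ∈ univ.filter (fun c' => ∃ k < Fintype.card C,
            (σ ^ k) c' = e c ∧ ∀ l < k, (σ ^ l) c' ∉ B) :=
          mem_filter.2 ⟨mem_univ _, k + 1, hk, hke, hkl⟩
        rw [bkwStrand_lift_apply_of_mem_strand he hL₂ f heB hσc,
          bkwStrand_lift_apply_of_mem_strand he hL₂ f heB hcc]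
  · intro c hcB
    have hD : ¬ Disjoint (PairingGenus.cls σ c) B :=
      bkwStrand_not_disjoint_iff.2 ⟨0, by simpa using hcB⟩
    obtain ⟨heB, k, -, hke, hkl⟩ := he c hD
    rw [hL₂ f c hD, bkwStrand_end_unique heB hcB hke hkl (k' := 0) (by simp)
      (fun l hl => absurd hl (Nat.not_lt_zero l))]

/-- A consistent arrow configuration is constant on every uncut cycle. [cite: BaxterKellandWu1976, §3] -/
theorem bkwStrand_apply_eq_of_mem_uncut {s : C → Bool} (hs : ∀ c, c ∉ B → s (σ c) = s c)
    (S : ↥((cycles σ).filter (fun S => Disjoint S B))) {x y : C} (hx : x ∈ S.1) (hy : y ∈ S.1) :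
    s x = s y := by
  have hxS := bkwStrand_cls_eq_of_mem (mem_filter.1 S.2).1 hx
  have hyS := bkwStrand_cls_eq_of_mem (mem_filter.1 S.2).1 hy
  have hxy : σ.SameCycle x y := PairingGenus.cls_eq_cls_iff.1 (hxS.trans hyS.symm)
  obtain ⟨n, rfl⟩ := hxy.exists_nat_pow_eq
  refine (bkwStrand_apply_pow_eq hs x fun l _ => ?_).symm
  have hl : (σ ^ l) x ∈ PairingGenus.cls σ x := PairingGenus.mem_cls.2 ⟨l, by rw [zpow_natCast]⟩
  rw [hxS] at hl
  exact disjoint_left.1 (mem_filter.1 S.2).2 hl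

/-- **Every consistent arrow configuration with the forced bits on `B` is a lift.** [cite: BaxterKellandWu1976, §3] -/
theorem bkwStrand_exists_lift_eq
    (he : ∀ c, ¬ Disjoint (PairingGenus.cls σ c) B →
      e c ∈ B ∧ ∃ k < Fintype.card C, (σ ^ k) c = e c ∧ ∀ l < k, (σ ^ l) c ∉ B)
    (hL₁ : ∀ f c (h : Disjoint (PairingGenus.cls σ c) B),
      L f c = f ⟨PairingGenus.cls σ c, bkwStrand_cls_mem_uncut h⟩)
    (hL₂ : ∀ f c, ¬ Disjoint (PairingGenus.cls σ c) B → L f c = o (e c))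
    {s : C → Bool} (hs : ∀ c, c ∉ B → s (σ c) = s c) (hso : ∀ c ∈ B, s c = o c) :
    ∃ f, L f = s := by
  have hrep : ∀ S : ↥((cycles σ).filter (fun S => Disjoint S B)), ∃ c, c ∈ S.1 := fun S => by
    obtain ⟨c, -, hc⟩ := mem_image.1 (mem_filter.1 S.2).1
    exact ⟨c, hc ▸ PairingGenus.mem_cls_self σ c⟩
  choose rep hrep using hrep
  refine ⟨fun S => s (rep S), funext fun c => ?_⟩
  by_cases hD : Disjoint (PairingGenus.cls σ c) B
  · rw [bkwStrand_lift_apply_of_mem hL₁ _ ⟨_, bkwStrand_cls_mem_uncut hD⟩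
      (PairingGenus.mem_cls_self σ c)]
    exact bkwStrand_apply_eq_of_mem_uncut hs _ (hrep _) (PairingGenus.mem_cls_self σ c)
  · obtain ⟨heB, k, -, hke, hkl⟩ := he c hD
    rw [hL₂ _ c hD, ← hso _ heB, ← hke]
    exact bkwStrand_apply_pow_eq hs c hkl

/-- **The lift is injective** (every cycle is nonempty). [folklore] -/
theorem bkwStrand_lift_injective
    (hL₁ : ∀ f c (h : Disjoint (PairingGenus.cls σ c) B),
      L f c = f ⟨PairingGenus.cls σ c, bkwStrand_cls_mem_uncut h⟩) :
    Function.Injective L := by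
  intro f f' h
  funext S
  obtain ⟨c, -, hc⟩ := mem_image.1 (mem_filter.1 S.2).1
  have hcS : c ∈ S.1 := hc ▸ PairingGenus.mem_cls_self σ c
  rw [← bkwStrand_lift_apply_of_mem hL₁ f S hcS, ← bkwStrand_lift_apply_of_mem hL₁ f' S hcS, h]

/-- **The consistent arrow configurations with forced bits on `B` are exactly the lifts of the
bits on the uncut cycles.** [cite: BaxterKellandWu1976, §3] -/
theorem bkwStrand_filter_eq_image
    (he : ∀ c, ¬ Disjoint (PairingGenus.cls σ c) B →
      e c ∈ B ∧ ∃ k < Fintype.card C, (σ ^ k) c = e c ∧ ∀ l < k, (σ ^ l) c ∉ B)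
    (hL₁ : ∀ f c (h : Disjoint (PairingGenus.cls σ c) B),
      L f c = f ⟨PairingGenus.cls σ c, bkwStrand_cls_mem_uncut h⟩)
    (hL₂ : ∀ f c, ¬ Disjoint (PairingGenus.cls σ c) B → L f c = o (e c)) :
    (univ.filter fun s : C → Bool => (∀ c, c ∉ B → s (σ c) = s c) ∧ ∀ c ∈ B, s c = o c) =
      univ.image L := by
  ext s
  simp only [mem_filter, mem_univ, true_and, mem_image]
  constructor
  · rintro ⟨hs, hso⟩
    exact bkwStrand_exists_lift_eq he hL₁ hL₂ hs hso
  · rintro ⟨f, rfl⟩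
    exact bkwStrand_lift_mem he hL₁ hL₂ f

/-- **The phase of a lift splits along uncut cycles and strands**:
`∏_c exp(i ε(L f c) g c) = ∏_S exp(i ε(f S) ∑_{c∈S} g c) · ∏_{b∈B} exp(i ε(o b) ∑_{c∈T_b} g c)`. [cite: BaxterKellandWu1976, §3] -/
theorem bkwStrand_prod_lift
    (he : ∀ c, ¬ Disjoint (PairingGenus.cls σ c) B →
      e c ∈ B ∧ ∃ k < Fintype.card C, (σ ^ k) c = e c ∧ ∀ l < k, (σ ^ l) c ∉ B)
    (hL₁ : ∀ f c (h : Disjoint (PairingGenus.cls σ c) B),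
      L f c = f ⟨PairingGenus.cls σ c, bkwStrand_cls_mem_uncut h⟩)
    (hL₂ : ∀ f c, ¬ Disjoint (PairingGenus.cls σ c) B → L f c = o (e c))
    (f : ↥((cycles σ).filter (fun S => Disjoint S B)) → Bool) (g : C → ℝ) :
    ∏ c, Complex.exp (I * (sgn (L f c) : ℂ) * (g c : ℂ)) =
      (∏ S : ↥((cycles σ).filter (fun S => Disjoint S B)),
          Complex.exp (I * (sgn (f S) : ℂ) * ∑ c ∈ S.1, (g c : ℂ))) *
        ∏ b ∈ B, Complex.exp (I * (sgn (o b) : ℂ) * ∑ c ∈ univ.filter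
          (fun c => ∃ k < Fintype.card C, (σ ^ k) c = b ∧ ∀ l < k, (σ ^ l) c ∉ B), (g c : ℂ)) := by
  rw [bkwStrand_prod_split he]
  congr 1
  · rw [← prod_coe_sort]
    refine prod_congr rfl fun S _ => ?_
    rw [mul_sum, Complex.exp_sum]
    exact prod_congr rfl fun c hc => by rw [bkwStrand_lift_apply_of_mem hL₁ f S hc]
  · refine prod_congr rfl fun b hb => ?_
    rw [mul_sum, Complex.exp_sum]
    exact prod_congr rfl fun c hc => by rw [bkwStrand_lift_apply_of_mem_strand he hL₂ f hb hc]

end Lift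

/-! ### The orientation expansion with cut loops -/

/-- **Baxter–Kelland–Wu orientation expansion with cut loops, forced orientations.** For a
permutation `σ` of a finite type of corners cut after the corners of `B`, prescribed bits
`o` on `B` and any `g`,
`∑_{s : s (σ c) = s c (c ∉ B), s = o on B} ∏_c exp(i ε(s c) g c)
   = ∏_{S uncut cycle} 2cos(∑_{c∈S} g c) · ∏_{b∈B} exp(i ε(o b) ∑_{c∈T_b} g c)`,
`T_b = {c | ∃ k < card C, σ^k c = b, σ^l c ∉ B (l < k)}` the strand ending at `b`: uncut loops
are summed over their two orientations, each open strand carries the single phase of its forced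
orientation. [cite: BaxterKellandWu1976, §3] -/
theorem bkwStrand_sum_consistent_forced (σ : Perm C) (B : Finset C) (o : C → Bool) (g : C → ℝ) :
    ∑ s ∈ univ.filter (fun s : C → Bool => (∀ c, c ∉ B → s (σ c) = s c) ∧ ∀ c ∈ B, s c = o c),
        ∏ c, Complex.exp (I * (sgn (s c) : ℂ) * (g c : ℂ)) =
      (∏ S ∈ (cycles σ).filter (fun S => Disjoint S B), 2 * Complex.cos (∑ c ∈ S, (g c : ℂ))) *
        ∏ b ∈ B, Complex.exp (I * (sgn (o b) : ℂ) * ∑ c ∈ univ.filter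
          (fun c => ∃ k < Fintype.card C, (σ ^ k) c = b ∧ ∀ l < k, (σ ^ l) c ∉ B), (g c : ℂ)) := by
  classical
  obtain ⟨e, he⟩ := bkwStrand_exists_endFun σ B
  set L : (↥((cycles σ).filter (fun S => Disjoint S B)) → Bool) → C → Bool := fun f c =>
    if h : Disjoint (PairingGenus.cls σ c) B then f ⟨PairingGenus.cls σ c, bkwStrand_cls_mem_uncut h⟩
    else o (e c) with hL
  have hL₁ : ∀ f c (h : Disjoint (PairingGenus.cls σ c) B),
      L f c = f ⟨PairingGenus.cls σ c, bkwStrand_cls_mem_uncut h⟩ := fun f c h => dif_pos h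
  have hL₂ : ∀ f c, ¬ Disjoint (PairingGenus.cls σ c) B → L f c = o (e c) := fun f c h => dif_neg h
  rw [bkwStrand_filter_eq_image he hL₁ hL₂, sum_image fun f _ f' _ h => bkwStrand_lift_injective hL₁ h,
    sum_congr rfl fun f _ => bkwStrand_prod_lift he hL₁ hL₂ f g, ← sum_mul]
  congr 1
  have hR : ∏ S ∈ (cycles σ).filter (fun S => Disjoint S B), (2 * Complex.cos (∑ c ∈ S, (g c : ℂ))) =
      ∏ S : ↥((cycles σ).filter (fun S => Disjoint S B)), ∑ b ∈ (univ : Finset Bool),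
        Complex.exp (I * (sgn b : ℂ) * ∑ c ∈ S.1, (g c : ℂ)) := by
    rw [← prod_coe_sort]
    exact prod_congr rfl fun S _ => (sum_bool_exp_sgn _).symm
  rw [hR, prod_univ_sum, Fintype.piFinset_univ]

/-! ### Registered sub-goal of this Part -/

/-- **Sub-goal `s12_bkwStrandExpansion`** (registered on stmt-CriticalPhenomena-14132) — the
algebraic core of the insertion dictionary D2: the Baxter–Kelland–Wu orientation expansion with
forced strand orientations, for a permutation `σ` of a finite type `C` of corners cut after the
corners of `B : Finset C`, prescribed bits `o` on `B`, strands indexed by their last corner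
`b ∈ B` (`T_b = {c | ∃ k < card C, σ^k c = b ∧ ∀ l < k, σ^l c ∉ B}`). [cite: BaxterKellandWu1976, §3] -/
theorem s12_bkwStrandExpansion : ∀ (C : Type) [Fintype C] [DecidableEq C] (σ : Equiv.Perm C) (B : Finset C) (o : C → Bool) (g : C → ℝ), ∑ s ∈ Finset.univ.filter (fun s : C → Bool => (∀ c, c ∉ B → s (σ c) = s c) ∧ ∀ c ∈ B, s c = o c), ∏ c, Complex.exp (Complex.I * (Literature.Probability.Percolation.BKW.sgn (s c) : ℂ) * (g c : ℂ)) = (∏ S ∈ (Literature.Probability.Percolation.BKW.cycles σ).filter (fun S => Disjoint S B), 2 * Complex.cos (∑ c ∈ S, (g c : ℂ))) * ∏ b ∈ B, Complex.exp (Complex.I * (Literature.Probability.Percolation.BKW.sgn (o b) : ℂ) * ∑ c ∈ Finset.univ.filter (fun c : C => ∃ k < Fintype.card C, (σ ^ k) c = b ∧ ∀ l < k, (σ ^ l) c ∉ B), (g c : ℂ)) :=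
  fun _ _ _ σ B o g => bkwStrand_sum_consistent_forced σ B o g

end Summit.CriticalPhenomena.CardyFormulaZ2.Cruxes.BoundaryDefectGaussianR.RainbowMonomialsInExcursionKernels

end
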